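import Literature.Computability.QuantumComplexity.OddSVTDegreeBookkeeping
import Literature.Computability.QuantumComplexity.EvenSVTOutputSampling
import HarnessLib

/-!
# Odd singular value transformation — the output step: `v = A′R′ᵀ·ḡ(CCᵀ)·u + q(0)·A″b″`, its
# five-term error split, the three approximate-matrix-product budgets, and oversampling access
# to `v` as a linear combination of sampled columns of `A` (CGLLTW 2022, §3.3 proof of Theorem 3.4,
# odd case)

Chia, Gilyén, Li, Lin, Tang, Wang, J. ACM 69(5):33 (2022) = arXiv:1910.06151, §3.3, proof of
Theorem 3.4, odd case (held arXiv text p. 21 L40–88).  With `p(A) = A·q(AᵀA)` and the matrix-level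
event `‖A(Rᵀḡ(CCᵀ)R + q(0)I) − A·q(AᵀA)‖_F ≤ ‖A‖_F·ε` of `OddPolySVT.odd_polynomial_svt`
(`OddSVTDegreeBookkeeping`, Frobenius currency), the print continues:

> We now use the approximating matrix product lemmas three times.  • approximate `AR† ≈ A′R′†`
> … since we have `SQ(A†)` (by assumption) and `SQ(R†)` …  • approximate `Rb ≈ u` …  • using
> `SQ(b)`, approximate `Ab ≈ A″b″` …  So `v := A′R′†ḡ(CC†)u + q(0)A″b″` satisfies
> `‖v − p(A)b‖ ≲ ε`.  `v` is a linear combination of columns of `A`; via (lemma:sample-Mv), we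
> can get `SQ_φ(v)` …

This module types that step at the sampling level, for ANY `R : s × n`, `M : s × s`, scalar `q₀`,
target `F : n × n` (at the theorem: `R = S_ωA`, `M = ḡ_clamp(CCᵀ)`, `q₀ = q(0)`, `F = q(AᵀA)`):

* **`odd_output_sub_eq`, `odd_output_error_le`** — the deterministic five-term split
  `PMu + q₀y − AFb = (AG − AF)b + ARᵀM(u − Rb) + (P − ARᵀ)MRb + (P − ARᵀ)M(u − Rb) + q₀(y − Ab)`
  (`G = RᵀMR + q₀I`, `P ≈ ARᵀ`, `u ≈ Rb`, `y ≈ Ab`) and its norm bound; term 1 is the odd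
  matrix-level event applied to `b` (`odd_output_error_le_of_event`);
* **`iid_frobSq_colSketch_sub_le`, `iid_mass_frobSq_colSketch_sub_ge_le`** — `P = A′R′ᵀ :=
  (S₁Aᵀ)ᵀ(S₁Rᵀ)` with `S₁` the importance-sampling sketch of `σ₁` column indices i.i.d. from
  `𝒟_{Ã-columns}` (`SQ_{φ_c}(Aᵀ)`): `E‖P − ARᵀ‖_F² ≤ (φ_c/σ₁)‖A‖_F²‖R‖_F²` and its Chebyshev form —
  the tree's `ApproxMatrixProduct.iid_frobSq_sub_le` / `iid_mass_frobSq_sub_ge_le` at `X = Aᵀ`,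
  `Y = Rᵀ`, BY NAME; `u ≈ Rb` and `y = A″b″ ≈ Ab` are `EvenPolySVT.Output.matVecEst` (module
  `EvenSVTOutputSampling`) at `R` and at `R := A`, with its budget
  `iid_mass_normSq_matVecEst_sub_ge_le` BY NAME;
* **`odd_output_error_mass`** — the three-stage join: for `η₁, η₂, η₃ > 0`, `δ′ > 0`, if
  `σ₁ ≥ 3φ_c‖A‖_F²‖R‖_F²/(η₁²δ′)`, `σ₂ ≥ 3φ_b‖R‖_F²‖b‖²/(η₂²δ′)`, `σ₃ ≥ 3φ_b‖A‖_F²‖b‖²/(η₃²δ′)` then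
  `mass_{ω₁,ω₂,ω₃}{ ‖v − AFb‖ ≤ ‖AG − AF‖_F‖b‖ + ‖ARᵀM‖_F·η₂ + η₁‖MR‖_F‖b‖ + η₁‖M‖_F·η₂ + |q₀|η₃ }
  ≥ 1 − δ′` (product of the three i.i.d. weights; union bound of three Chebyshev events);
* **`stackRows`, `odd_output_eq_stack`, `oddOutputWitness`, `oddSketchWitness`,
  `normSq_oddOutputTilde`** — `v = (S₁Aᵀ)ᵀz₁ + (S₃Aᵀ)ᵀz₃` is ONE linear combination of the
  `σ₁ + σ₃` sampled (rescaled) columns of `A`; oversampling access to it is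
  `EvenPolySVT.Output.outputWitness`'s dominating-data pattern over the stacked rows
  (`S₁Ãᵀ`, `S₃Ãᵀ` dominate `S₁Aᵀ`, `S₃Aᵀ` entrywise by the tree's `sketch_sq_le_sketch_tilde_sq`),
  with `φ_v·‖v‖² = (σ₁ + σ₃ + 1)(Σ_t z₁(t)²‖(S₁Ãᵀ)_t‖² + Σ_t z₃(t)²‖(S₃Ãᵀ)_t‖²)` — the print's display
  `Σ_i ‖A′(·,i)‖²|z₁(i)|² + Σ_j q(0)²‖A″(·,j)‖²|b″(j)|²` over dominating data.

HONEST SCOPE.  Finite weighted sums with the tree's i.i.d. product weights (`iidWeight`), all three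
approximate products entering BY NAME (no second engine); Frobenius currency throughout (the
print's operator norms `‖AR† − A′R′†‖`, `‖√ḡ(CC†)‖`, `‖R†ḡ‖ ≲ d²` are NOT typed — `‖ARᵀM‖_F`, `‖MR‖_F`,
`‖M‖_F` stay parameters of the outcome `(R, M)`); thresholds PER OUTCOME of the earlier stages and
Chebyshev `1/δ′` (union bound over three stages), NOT median-of-means / `log(1/δ)`; the print's
sizing of `σ₁, σ₂, σ₃` by operator norms (`d⁴ε⁻²δ⁻¹` etc.), query / time counts (`σ₁` samples of
`𝒟_{Ã-columns}`, `σ₂ + σ₃` of `𝒟_{b̃}`, `σ₁·s + σ₃` column reads) and any algorithm object are NOT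
modelled; nothing on the even case beyond the imports.  Nothing here bears on `BQP` vs `BPP`.  All
statements are theorems or explicit data (`stackRows`, `oddOutputWitness`, `oddSketchWitness`); no
named facts; standard axioms.
-/

noncomputable section

open scoped Matrix
open Finset

namespace Literature.Computability.QuantumComplexity.SampleQuery.OddPolySVT.Output

open EvenPolySVT.Output

variable {m n s σ₁ σ₂ σ₃ : ℕ}

/-! ### §0 Norm bookkeeping (`‖·‖ = √normSq`, `‖·‖_F = √frobSq`) -/

/-- `‖Xy‖² ≤ ‖X‖_F²‖y‖²` (Cauchy–Schwarz row by row). [folklore] -/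
private theorem normSq_mulVec_le {k l : ℕ} (X : Matrix (Fin k) (Fin l) ℝ) (y : Fin l → ℝ) :
    normSq (X *ᵥ y) ≤ frobSq X * normSq y := by
  unfold frobSq
  rw [Finset.sum_mul]
  refine Finset.sum_le_sum fun i _ => ?_
  have h : (X *ᵥ y) i = ∑ j, X i j * y j := rfl
  rw [h]
  exact Finset.sum_mul_sq_le_sq_mul_sq _ _ _

/-- `‖Xy‖ ≤ ‖X‖_F‖y‖`. [folklore] -/
private theorem sqrt_normSq_mulVec_le {k l : ℕ} (X : Matrix (Fin k) (Fin l) ℝ) (y : Fin l → ℝ) :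
    Real.sqrt (normSq (X *ᵥ y)) ≤ Real.sqrt (frobSq X) * Real.sqrt (normSq y) := by
  rw [← Real.sqrt_mul (frobSq_nonneg X)]
  exact Real.sqrt_le_sqrt (normSq_mulVec_le X y)

/-- Triangle inequality for `√normSq`. [folklore] -/
private theorem sqrt_normSq_add_le {l : ℕ} (u w : Fin l → ℝ) :
    Real.sqrt (normSq (u + w)) ≤ Real.sqrt (normSq u) + Real.sqrt (normSq w) := by
  have hu := Real.sqrt_nonneg (normSq u)
  have hw := Real.sqrt_nonneg (normSq w)
  rw [Real.sqrt_le_left (by positivity)]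
  have hcs' := Real.sum_mul_le_sqrt_mul_sqrt Finset.univ (fun i => |u i|) (fun i => |w i|)
  have hcs : ∑ i, u i * w i ≤ Real.sqrt (normSq u) * Real.sqrt (normSq w) := by
    refine (sum_le_sum fun i _ => (le_abs_self _).trans_eq (abs_mul (u i) (w i))).trans ?_
    simpa [normSq, sq_abs] using hcs'
  have hexp : normSq (u + w) = normSq u + 2 * ∑ i, u i * w i + normSq w := by
    simp only [normSq, Pi.add_apply, add_sq, sum_add_distrib, mul_sum]
    ring_nf
  rw [hexp, add_sq, Real.sq_sqrt (normSq_nonneg u), Real.sq_sqrt (normSq_nonneg w)]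
  nlinarith

/-- `‖c·v‖ = |c|·‖v‖`. [folklore] -/
private theorem sqrt_normSq_smul {l : ℕ} (c : ℝ) (v : Fin l → ℝ) :
    Real.sqrt (normSq (c • v)) = |c| * Real.sqrt (normSq v) := by
  rw [normSq_smul, Real.sqrt_mul (sq_nonneg c), Real.sqrt_sq_eq_abs]

/-- Threshold arithmetic: `σ ≥ 3φX/(η²δ)` gives the Chebyshev budget `(φ/σ)·X/η² ≤ δ/3`. [folklore] -/
private theorem budget_third {φ X σ η δ : ℝ} (hσ : 0 < σ) (hη : 0 < η) (hδ : 0 < δ)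
    (h : 3 * φ * X / (η ^ 2 * δ) ≤ σ) : φ / σ * X / η ^ 2 ≤ δ / 3 := by
  have hη2 : η ^ 2 ≠ 0 := by positivity
  calc φ / σ * X / η ^ 2 = 3 * φ * X / (η ^ 2 * δ) * (δ / (3 * σ)) := by
        field_simp
    _ ≤ σ * (δ / (3 * σ)) := mul_le_mul_of_nonneg_right h (by positivity)
    _ = δ / 3 := by
        field_simp

/-! ### §1 The deterministic five-term split of the odd output error -/

/-- **Five-term split.**  For any `P ≈ ARᵀ`, `u ≈ Rb`, `y ≈ Ab`:
`PMu + q₀y − AFb = (A(RᵀMR + q₀I) − AF)b + ARᵀM(u − Rb) + (P − ARᵀ)(MR)b + (P − ARᵀ)M(u − Rb)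
+ q₀(y − Ab)` — term 1 is the odd matrix-level event's matrix applied to `b`, terms 3–4 the
`AR† ≈ A′R′†` error, terms 2 and 4 the `Rb ≈ u` error, term 5 the `Ab ≈ A″b″` error.
[cite: ChiaEtAl2022, §3.3 proof of Theorem 3.4, odd case (the three approximation bullets and
`v := A′R′†ḡ(CC†)u + q(0)A″b″`, held arXiv text p. 21 L47–71)] -/
theorem odd_output_sub_eq (A : Matrix (Fin m) (Fin n) ℝ) (R : Matrix (Fin s) (Fin n) ℝ)
    (M : Matrix (Fin s) (Fin s) ℝ) (F : Matrix (Fin n) (Fin n) ℝ) (P : Matrix (Fin m) (Fin s) ℝ)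
    (q0 : ℝ) (u : Fin s → ℝ) (y : Fin m → ℝ) (b : Fin n → ℝ) :
    P *ᵥ (M *ᵥ u) + q0 • y - A *ᵥ (F *ᵥ b) =
      (A * (Rᵀ * M * R + q0 • (1 : Matrix (Fin n) (Fin n) ℝ)) - A * F) *ᵥ b
        + (A * Rᵀ * M) *ᵥ (u - R *ᵥ b)
        + (P - A * Rᵀ) *ᵥ ((M * R) *ᵥ b)
        + (P - A * Rᵀ) *ᵥ (M *ᵥ (u - R *ᵥ b))
        + q0 • (y - A *ᵥ b) := by
  simp only [Matrix.sub_mulVec, Matrix.add_mulVec, Matrix.mulVec_sub, Matrix.mulVec_add,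
    Matrix.smul_mulVec, Matrix.one_mulVec, Matrix.mulVec_smul, smul_sub, ← Matrix.mulVec_mulVec]
  abel

/-- **Deterministic error bound for the odd output** (`‖·‖ = √normSq`, `‖·‖_F = √frobSq`):
`‖PMu + q₀y − AFb‖ ≤ ‖A(RᵀMR + q₀I) − AF‖_F‖b‖ + ‖ARᵀM‖_F‖u − Rb‖ + ‖P − ARᵀ‖_F·‖MR‖_F‖b‖
+ ‖P − ARᵀ‖_F·‖M‖_F‖u − Rb‖ + |q₀|·‖y − Ab‖` (Frobenius currency; the print bounds the same terms
with operator norms `‖√ḡ(CC†)‖`, `‖R†ḡ(CC†)‖ ≲ d²`, not typed here).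
[cite: ChiaEtAl2022, §3.3 proof of Theorem 3.4, odd case (the two displayed chains
`‖(AR† − A′R′†)ḡ(CC†)R‖ ≲ ε`, `‖A′R′†ḡ(CC†)(Rb − u)‖ ≲ ε` and `q(0)‖Ab − A″b″‖ ≤ ε`, p. 21 L51–69)] -/
theorem odd_output_error_le (A : Matrix (Fin m) (Fin n) ℝ) (R : Matrix (Fin s) (Fin n) ℝ)
    (M : Matrix (Fin s) (Fin s) ℝ) (F : Matrix (Fin n) (Fin n) ℝ) (P : Matrix (Fin m) (Fin s) ℝ)
    (q0 : ℝ) (u : Fin s → ℝ) (y : Fin m → ℝ) (b : Fin n → ℝ) :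
    Real.sqrt (normSq (P *ᵥ (M *ᵥ u) + q0 • y - A *ᵥ (F *ᵥ b))) ≤
      Real.sqrt (frobSq (A * (Rᵀ * M * R + q0 • (1 : Matrix (Fin n) (Fin n) ℝ)) - A * F)) *
          Real.sqrt (normSq b)
        + Real.sqrt (frobSq (A * Rᵀ * M)) * Real.sqrt (normSq (u - R *ᵥ b))
        + Real.sqrt (frobSq (P - A * Rᵀ)) * (Real.sqrt (frobSq (M * R)) * Real.sqrt (normSq b))
        + Real.sqrt (frobSq (P - A * Rᵀ)) *
          (Real.sqrt (frobSq M) * Real.sqrt (normSq (u - R *ᵥ b)))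
        + |q0| * Real.sqrt (normSq (y - A *ᵥ b)) := by
  rw [odd_output_sub_eq A R M F P q0 u y b]
  refine (sqrt_normSq_add_le _ _).trans (add_le_add ((sqrt_normSq_add_le _ _).trans
    (add_le_add ((sqrt_normSq_add_le _ _).trans (add_le_add ((sqrt_normSq_add_le _ _).trans
    (add_le_add (sqrt_normSq_mulVec_le _ _) (sqrt_normSq_mulVec_le _ _))) ?_)) ?_)) ?_)
  · exact (sqrt_normSq_mulVec_le _ _).trans
      (mul_le_mul_of_nonneg_left (sqrt_normSq_mulVec_le _ _) (Real.sqrt_nonneg _))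
  · exact (sqrt_normSq_mulVec_le _ _).trans
      (mul_le_mul_of_nonneg_left (sqrt_normSq_mulVec_le _ _) (Real.sqrt_nonneg _))
  · exact (sqrt_normSq_smul _ _).le

/-- **Term 1 on the odd matrix-level event.**  If `‖A(RᵀMR + q₀I) − AF‖_F ≤ ‖A‖_F·ε` (the event
of `OddPolySVT.odd_polynomial_svt` at the outcome `(R, M) = (S_ωA, ḡ_clamp(CCᵀ))`, `q₀ = q(0)`,
`F = q(AᵀA)`), the first term is `≤ ‖A‖_F·ε·‖b‖`. [cite: ChiaEtAl2022, §3.3 proof of Theorem 3.4,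
odd case ("we get `R, C` such that `‖R†ḡ(CC†)R + g(0)I − g(A†A)‖ < ε/‖A‖`", p. 21 L42)] -/
theorem odd_output_error_le_of_event (A : Matrix (Fin m) (Fin n) ℝ) (R : Matrix (Fin s) (Fin n) ℝ)
    (M : Matrix (Fin s) (Fin s) ℝ) (F : Matrix (Fin n) (Fin n) ℝ) (P : Matrix (Fin m) (Fin s) ℝ)
    (q0 : ℝ) (u : Fin s → ℝ) (y : Fin m → ℝ) (b : Fin n → ℝ) {ε : ℝ}
    (hE : Real.sqrt (frobSq (A * (Rᵀ * M * R + q0 • (1 : Matrix (Fin n) (Fin n) ℝ)) - A * F)) ≤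
      Real.sqrt (frobSq A) * ε) :
    Real.sqrt (normSq (P *ᵥ (M *ᵥ u) + q0 • y - A *ᵥ (F *ᵥ b))) ≤
      Real.sqrt (frobSq A) * ε * Real.sqrt (normSq b)
        + Real.sqrt (frobSq (A * Rᵀ * M)) * Real.sqrt (normSq (u - R *ᵥ b))
        + Real.sqrt (frobSq (P - A * Rᵀ)) * (Real.sqrt (frobSq (M * R)) * Real.sqrt (normSq b))
        + Real.sqrt (frobSq (P - A * Rᵀ)) *
          (Real.sqrt (frobSq M) * Real.sqrt (normSq (u - R *ᵥ b)))
        + |q0| * Real.sqrt (normSq (y - A *ᵥ b)) :=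
  (odd_output_error_le A R M F P q0 u y b).trans (by gcongr)

/-! ### §2 The `AR† ≈ A′R′†` budget (sampling columns of `A` from `SQ_{φ_c}(Aᵀ)`) -/

/-- **`E_{ω₁}‖A′R′ᵀ − ARᵀ‖_F² ≤ (φ_c/σ₁)‖A‖_F²‖R‖_F²`** with `A′R′ᵀ = (S₁Aᵀ)ᵀ(S₁Rᵀ)`, `S₁` the sketch of
`σ₁ ≥ 1` column indices i.i.d. from `𝒟_{Ã-columns} = rowDist(Ãᵀ)` (`SQ_{φ_c}(Aᵀ)` with witness `Ãᵀ`,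
`A ≠ 0`): the tree's `iid_frobSq_sub_le` at `X = Aᵀ`, `Y = Rᵀ`.
[cite: ChiaEtAl2022, §3.3 proof of Theorem 3.4, odd case, first bullet ("We can do this since we
have `SQ(A†)` … and `SQ(R†)`, in `‖A‖_F²‖R‖_F²d⁴ε⁻²δ⁻¹` samples", p. 21 L49–50);
DrineasKannanMahoney2006, App. A.3 Lemma 8] -/
theorem iid_frobSq_colSketch_sub_le {ϕc : ℝ} {A : Matrix (Fin m) (Fin n) ℝ}
    (Wc : MatrixOversamplingWitness ϕc Aᵀ) (hA : A ≠ 0) (hσ : σ₁ ≠ 0)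
    (R : Matrix (Fin s) (Fin n) ℝ) :
    ∑ ω : Fin σ₁ → Fin n, iidWeight (rowDist Wc.tilde) ω *
        frobSq ((sketch (rowDist Wc.tilde) ω * Aᵀ)ᵀ * (sketch (rowDist Wc.tilde) ω * Rᵀ) -
          A * Rᵀ) ≤
      ϕc / σ₁ * (frobSq A * frobSq R) := by
  have hAt : Aᵀ ≠ 0 := fun h => hA (by simpa using congrArg Matrix.transpose h)
  have h := iid_frobSq_sub_le (Wc.isOversampledDist_rowDist hAt) (Wc.pos hAt) hσ Rᵀ
  simpa only [Matrix.transpose_transpose, frobSq_transpose] using h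

/-- **Chebyshev form: `mass_{ω₁}{‖A′R′ᵀ − ARᵀ‖_F² ≥ a} ≤ φ_c‖A‖_F²‖R‖_F²/(σ₁·a)`** (`a > 0`) — the
tree's `iid_mass_frobSq_sub_ge_le` at `X = Aᵀ`, `Y = Rᵀ`.
[cite: ChiaEtAl2022, §3.3 proof of Theorem 3.4, odd case, first bullet (p. 21 L49–50)] -/
theorem iid_mass_frobSq_colSketch_sub_ge_le {ϕc : ℝ} {A : Matrix (Fin m) (Fin n) ℝ}
    (Wc : MatrixOversamplingWitness ϕc Aᵀ) (hA : A ≠ 0) (hσ : σ₁ ≠ 0)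
    (R : Matrix (Fin s) (Fin n) ℝ) {a : ℝ} (ha : 0 < a) :
    ∑ ω ∈ univ.filter (fun ω : Fin σ₁ → Fin n =>
        a ≤ frobSq ((sketch (rowDist Wc.tilde) ω * Aᵀ)ᵀ * (sketch (rowDist Wc.tilde) ω * Rᵀ) -
          A * Rᵀ)), iidWeight (rowDist Wc.tilde) ω ≤
      ϕc / σ₁ * (frobSq A * frobSq R) / a := by
  have hAt : Aᵀ ≠ 0 := fun h => hA (by simpa using congrArg Matrix.transpose h)
  have h := iid_mass_frobSq_sub_ge_le (Wc.isOversampledDist_rowDist hAt) (Wc.pos hAt) hσ Rᵀ ha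
  simpa only [Matrix.transpose_transpose, frobSq_transpose] using h

/-! ### §3 The three-stage join -/

/-- Good mass = 1 − bad mass, and it is at most 1 (probability weights). [folklore] -/
private theorem good_mass {ι : Type*} [Fintype ι] (w : ι → ℝ) (B : ι → Prop) [DecidablePred B]
    (hw : ∀ i, 0 ≤ w i) (hs : ∑ i, w i = 1) :
    ∑ i ∈ univ.filter (fun i => ¬ B i), w i = 1 - ∑ i ∈ univ.filter B, w i ∧
      ∑ i ∈ univ.filter (fun i => ¬ B i), w i ≤ 1 := by
  refine ⟨?_, ?_⟩
  · rw [← hs, ← sum_filter_add_sum_filter_not univ B]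
    ring
  · rw [← hs]
    exact sum_le_sum_of_subset_of_nonneg (filter_subset _ _) fun i _ _ => hw i

/-- Union bound over three independent stages, nested-sum form: if each stage's bad mass is
`≤ δᵢ` and the target event holds whenever all three outcomes are good, the nested good mass is
`≥ 1 − (δ₁ + δ₂ + δ₃)`. [folklore] -/
private theorem nested_mass_ge {ι₁ ι₂ ι₃ : Type*} [Fintype ι₁] [Fintype ι₂] [Fintype ι₃]
    (w₁ : ι₁ → ℝ) (w₂ : ι₂ → ℝ) (w₃ : ι₃ → ℝ) (h₁ : ∀ i, 0 ≤ w₁ i) (h₂ : ∀ i, 0 ≤ w₂ i)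
    (h₃ : ∀ i, 0 ≤ w₃ i) (s₁ : ∑ i, w₁ i = 1) (s₂ : ∑ i, w₂ i = 1) (s₃ : ∑ i, w₃ i = 1)
    (B₁ : ι₁ → Prop) (B₂ : ι₂ → Prop) (B₃ : ι₃ → Prop) (E : ι₁ → ι₂ → ι₃ → Prop)
    [DecidablePred B₁] [DecidablePred B₂] [DecidablePred B₃] [∀ i j, DecidablePred (E i j)]
    {δ₁ δ₂ δ₃ : ℝ} (m₁ : ∑ i ∈ univ.filter B₁, w₁ i ≤ δ₁)
    (m₂ : ∑ i ∈ univ.filter B₂, w₂ i ≤ δ₂) (m₃ : ∑ i ∈ univ.filter B₃, w₃ i ≤ δ₃)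
    (hE : ∀ i j k, ¬ B₁ i → ¬ B₂ j → ¬ B₃ k → E i j k) :
    1 - (δ₁ + δ₂ + δ₃) ≤ ∑ i, w₁ i * ∑ j, w₂ j * ∑ k ∈ univ.filter (E i j), w₃ k := by
  -- good masses `gᵢ = 1 − badᵢ ∈ [1 − δᵢ, 1]`
  obtain ⟨e₁, l₁⟩ := good_mass w₁ B₁ h₁ s₁
  obtain ⟨e₂, l₂⟩ := good_mass w₂ B₂ h₂ s₂
  obtain ⟨e₃, l₃⟩ := good_mass w₃ B₃ h₃ s₃
  set g₁ := ∑ i ∈ univ.filter (fun i => ¬ B₁ i), w₁ i with hg₁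
  set g₂ := ∑ i ∈ univ.filter (fun i => ¬ B₂ i), w₂ i with hg₂
  set g₃ := ∑ i ∈ univ.filter (fun i => ¬ B₃ i), w₃ i with hg₃
  have g₁0 : 0 ≤ g₁ := sum_nonneg fun i _ => h₁ i
  have g₂0 : 0 ≤ g₂ := sum_nonneg fun i _ => h₂ i
  have g₃0 : 0 ≤ g₃ := sum_nonneg fun i _ => h₃ i
  -- restrict the three sums to the good sets
  have hinner : ∀ i, ¬ B₁ i → g₂ * g₃ ≤ ∑ j, w₂ j * ∑ k ∈ univ.filter (E i j), w₃ k := by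
    intro i hi
    calc g₂ * g₃ = ∑ j ∈ univ.filter (fun j => ¬ B₂ j), w₂ j * g₃ := by rw [sum_mul]
      _ ≤ ∑ j ∈ univ.filter (fun j => ¬ B₂ j), w₂ j * ∑ k ∈ univ.filter (E i j), w₃ k := by
          refine sum_le_sum fun j hj => mul_le_mul_of_nonneg_left ?_ (h₂ j)
          rw [mem_filter] at hj
          exact sum_le_sum_of_subset_of_nonneg (fun k hk => by
            rw [mem_filter] at hk ⊢; exact ⟨hk.1, hE i j k hi hj.2 hk.2⟩) fun k _ _ => h₃ k
      _ ≤ ∑ j, w₂ j * ∑ k ∈ univ.filter (E i j), w₃ k :=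
          sum_le_sum_of_subset_of_nonneg (filter_subset _ _) fun j _ _ =>
            mul_nonneg (h₂ j) (sum_nonneg fun k _ => h₃ k)
  have houter : g₁ * (g₂ * g₃) ≤ ∑ i, w₁ i * ∑ j, w₂ j * ∑ k ∈ univ.filter (E i j), w₃ k := by
    calc g₁ * (g₂ * g₃) = ∑ i ∈ univ.filter (fun i => ¬ B₁ i), w₁ i * (g₂ * g₃) := by
          rw [sum_mul]
      _ ≤ ∑ i ∈ univ.filter (fun i => ¬ B₁ i), w₁ i *
            ∑ j, w₂ j * ∑ k ∈ univ.filter (E i j), w₃ k := by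
          refine sum_le_sum fun i hi => mul_le_mul_of_nonneg_left ?_ (h₁ i)
          rw [mem_filter] at hi
          exact hinner i hi.2
      _ ≤ ∑ i, w₁ i * ∑ j, w₂ j * ∑ k ∈ univ.filter (E i j), w₃ k :=
          sum_le_sum_of_subset_of_nonneg (filter_subset _ _) fun i _ _ =>
            mul_nonneg (h₁ i) (sum_nonneg fun j _ => mul_nonneg (h₂ j)
              (sum_nonneg fun k _ => h₃ k))
  -- `g₁g₂g₃ ≥ g₁ + g₂ + g₃ − 2 ≥ 1 − (δ₁ + δ₂ + δ₃)` on `[0,1]³`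
  have hprod : g₁ + g₂ + g₃ - 2 ≤ g₁ * (g₂ * g₃) := by
    nlinarith [mul_nonneg (sub_nonneg.2 l₁) (sub_nonneg.2 l₂),
      mul_nonneg (mul_nonneg g₁0 g₂0) (sub_nonneg.2 l₃), mul_nonneg g₁0 g₂0,
      mul_nonneg (sub_nonneg.2 l₃) (sub_nonneg.2 (show g₁ * g₂ ≤ 1 from by nlinarith))]
  linarith

/-- **The three-stage join (CGLLTW Thm 3.4, odd case, output step).**  Fix an outcome `(R, M)`
of the earlier stages, `q₀`, the target `F`, `SQ_{φ_c}(Aᵀ)` (witness `Ãᵀ`, `A ≠ 0`) and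
`SQ_{φ_b}(b)` (witness `b̃`, `b ≠ 0`).  Sample independently `ω₁` (`σ₁` column indices from
`𝒟_{Ã-columns}`, giving `P = A′R′ᵀ = (S₁Aᵀ)ᵀ(S₁Rᵀ)`), `ω₂` (`σ₂` indices from `𝒟_{b̃}`, giving
`u = matVecEst R b`), `ω₃` (`σ₃` indices from `𝒟_{b̃}`, giving `y = A″b″ = matVecEst A b`), and put
`v = PMu + q₀y`.  If **`σ₁ ≥ 3φ_c‖A‖_F²‖R‖_F²/(η₁²δ′)`, `σ₂ ≥ 3φ_b‖R‖_F²‖b‖²/(η₂²δ′)`,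
`σ₃ ≥ 3φ_b‖A‖_F²‖b‖²/(η₃²δ′)`** then
`mass{ ‖v − AFb‖ ≤ ‖A(RᵀMR + q₀I) − AF‖_F‖b‖ + ‖ARᵀM‖_F·η₂ + η₁·‖MR‖_F‖b‖ + η₁·‖M‖_F·η₂ + |q₀|·η₃ }
≥ 1 − δ′` (nested product of the three i.i.d. weights; three Chebyshev events of mass `≤ δ′/3`
each: `iid_mass_frobSq_colSketch_sub_ge_le` and `EvenPolySVT.Output.iid_mass_normSq_matVecEst_sub_ge_le`
twice, BY NAME).  On the event of `OddPolySVT.odd_polynomial_svt` the first term is `≤ ‖A‖_F·ε·‖b‖`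
(`odd_output_error_le_of_event`); the print then sizes `η₁ ≍ εd⁻²`, `η₂ ≍ ε/(d²‖A‖)`, `η₃ ≍ ε/d`
through operator-norm bounds NOT typed here, and uses median-of-means (`log 1/δ`) where this record
has Chebyshev (`1/δ′`); sample / query counts are described, not modelled.
[cite: ChiaEtAl2022, §3.3 proof of Theorem 3.4, odd case ("We now use the approximating matrix
product lemmas three times … So, we have shown that `v := A′R′†ḡ(CC†)u + q(0)A″b″` satisfies
`‖v − p(A)b‖ ≲ ε`", held arXiv text p. 21 L47–71)] -/
theorem odd_output_error_mass {ϕc φb : ℝ} {A : Matrix (Fin m) (Fin n) ℝ}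
    (Wc : MatrixOversamplingWitness ϕc Aᵀ) (hA : A ≠ 0) {b : Fin n → ℝ}
    (wb : OversamplingWitness φb b) (hb : b ≠ 0) (R : Matrix (Fin s) (Fin n) ℝ)
    (M : Matrix (Fin s) (Fin s) ℝ) (F : Matrix (Fin n) (Fin n) ℝ) (q0 : ℝ)
    (hσ₁ : 0 < σ₁) (hσ₂ : 0 < σ₂) (hσ₃ : 0 < σ₃) {η₁ η₂ η₃ δ' : ℝ} (hη₁ : 0 < η₁)
    (hη₂ : 0 < η₂) (hη₃ : 0 < η₃) (hδ' : 0 < δ')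
    (hσ₁L : 3 * ϕc * (frobSq A * frobSq R) / (η₁ ^ 2 * δ') ≤ σ₁)
    (hσ₂L : 3 * φb * (frobSq R * normSq b) / (η₂ ^ 2 * δ') ≤ σ₂)
    (hσ₃L : 3 * φb * (frobSq A * normSq b) / (η₃ ^ 2 * δ') ≤ σ₃) :
    1 - δ' ≤
      ∑ ω₁ : Fin σ₁ → Fin n, iidWeight (rowDist Wc.tilde) ω₁ *
        ∑ ω₂ : Fin σ₂ → Fin n, iidWeight (lengthSqDist wb.tilde) ω₂ *
          ∑ ω₃ ∈ univ.filter (fun ω₃ : Fin σ₃ → Fin n =>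
              Real.sqrt (normSq (((sketch (rowDist Wc.tilde) ω₁ * Aᵀ)ᵀ *
                    (sketch (rowDist Wc.tilde) ω₁ * Rᵀ)) *ᵥ
                      (M *ᵥ matVecEst R b (lengthSqDist wb.tilde) ω₂) +
                  q0 • matVecEst A b (lengthSqDist wb.tilde) ω₃ - A *ᵥ (F *ᵥ b))) ≤
                Real.sqrt (frobSq (A * (Rᵀ * M * R + q0 • (1 : Matrix (Fin n) (Fin n) ℝ)) -
                      A * F)) * Real.sqrt (normSq b)
                  + Real.sqrt (frobSq (A * Rᵀ * M)) * η₂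
                  + η₁ * (Real.sqrt (frobSq (M * R)) * Real.sqrt (normSq b))
                  + η₁ * (Real.sqrt (frobSq M) * η₂)
                  + |q0| * η₃),
            iidWeight (lengthSqDist wb.tilde) ω₃ := by
  classical
  set p₁ := rowDist Wc.tilde with hp₁
  set p₂ := lengthSqDist wb.tilde with hp₂
  have hAt : Aᵀ ≠ 0 := fun h => hA (by simpa using congrArg Matrix.transpose h)
  have hd₁ := Wc.isOversampledDist_rowDist hAt
  have hd₂ := wb.isOversampledDist hb
  have hσ₁' : (0 : ℝ) < σ₁ := by exact_mod_cast hσ₁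
  have hσ₂' : (0 : ℝ) < σ₂ := by exact_mod_cast hσ₂
  have hσ₃' : (0 : ℝ) < σ₃ := by exact_mod_cast hσ₃
  -- the three Chebyshev budgets, each ≤ δ'/3
  have m₁ := (iid_mass_frobSq_colSketch_sub_ge_le Wc hA (Nat.pos_iff_ne_zero.mp hσ₁) R
    (a := η₁ ^ 2) (by positivity)).trans (budget_third hσ₁' hη₁ hδ' hσ₁L)
  have m₂ := (iid_mass_normSq_matVecEst_sub_ge_le wb hb (Nat.pos_iff_ne_zero.mp hσ₂) R
    (a := η₂ ^ 2) (by positivity)).trans (budget_third hσ₂' hη₂ hδ' hσ₂L)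
  have m₃ := (iid_mass_normSq_matVecEst_sub_ge_le wb hb (Nat.pos_iff_ne_zero.mp hσ₃) A
    (a := η₃ ^ 2) (by positivity)).trans (budget_third hσ₃' hη₃ hδ' hσ₃L)
  have hsum : 1 - δ' = 1 - (δ' / 3 + δ' / 3 + δ' / 3) := by ring
  rw [hsum]
  refine nested_mass_ge _ _ _ (iidWeight_nonneg hd₁.nonneg) (iidWeight_nonneg hd₂.nonneg)
    (iidWeight_nonneg hd₂.nonneg) (sum_iidWeight hd₁.sum_eq_one) (sum_iidWeight hd₂.sum_eq_one)
    (sum_iidWeight hd₂.sum_eq_one) _ _ _ _ m₁ m₂ m₃ fun ω₁ ω₂ ω₃ g₁ g₂ g₃ => ?_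
  -- on the three good events: `‖P − ARᵀ‖_F < η₁`, `‖u − Rb‖ < η₂`, `‖y − Ab‖ < η₃`
  have e₁ : Real.sqrt (frobSq ((sketch p₁ ω₁ * Aᵀ)ᵀ * (sketch p₁ ω₁ * Rᵀ) - A * Rᵀ)) ≤ η₁ := by
    rw [← Real.sqrt_sq hη₁.le]; exact Real.sqrt_le_sqrt (not_le.mp g₁).le
  have e₂ : Real.sqrt (normSq (matVecEst R b p₂ ω₂ - R *ᵥ b)) ≤ η₂ := by
    rw [← Real.sqrt_sq hη₂.le]; exact Real.sqrt_le_sqrt (not_le.mp g₂).le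
  have e₃ : Real.sqrt (normSq (matVecEst A b p₂ ω₃ - A *ᵥ b)) ≤ η₃ := by
    rw [← Real.sqrt_sq hη₃.le]; exact Real.sqrt_le_sqrt (not_le.mp g₃).le
  refine (odd_output_error_le A R M F _ q0 _ _ b).trans ?_
  gcongr

/-! ### §4 Oversampling access to `v` — one linear combination of sampled columns of `A` -/

/-- The `(σ₁ + σ₃)`-row stack of two row families (here: the two sketched column families
`S₁Aᵀ`, `S₃Aᵀ` of `A`, resp. their dominating data `S₁Ãᵀ`, `S₃Ãᵀ`) — thin data: `v` is ONE linear
combination of these rows. [cite: ChiaEtAl2022, §3.3 proof of Theorem 3.4, odd case ("`v` is a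
linear combination of columns of `A`", p. 21 L72)] -/
def stackRows (X : Matrix (Fin σ₁) (Fin m) ℝ) (Y : Matrix (Fin σ₃) (Fin m) ℝ) :
    Matrix (Fin (σ₁ + σ₃)) (Fin m) ℝ :=
  fun t i => Fin.append X Y t i

/-- `[X; Y]ᵀ(z₁ ⊕ z₃) = Xᵀz₁ + Yᵀz₃`. [cite: ChiaEtAl2022, §3.3 proof of Theorem 3.4, odd case
(p. 21 L72)] -/
theorem stackRows_transpose_mulVec (X : Matrix (Fin σ₁) (Fin m) ℝ) (Y : Matrix (Fin σ₃) (Fin m) ℝ)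
    (z₁ : Fin σ₁ → ℝ) (z₃ : Fin σ₃ → ℝ) :
    (stackRows X Y)ᵀ *ᵥ Fin.append z₁ z₃ = Xᵀ *ᵥ z₁ + Yᵀ *ᵥ z₃ := by
  funext i
  simp only [Matrix.mulVec, dotProduct, Matrix.transpose_apply, Pi.add_apply, stackRows]
  rw [Fin.sum_univ_add]
  simp only [Fin.append_left, Fin.append_right]

/-- Rows of the first block. [folklore] -/
private theorem stackRows_castAdd (X : Matrix (Fin σ₁) (Fin m) ℝ) (Y : Matrix (Fin σ₃) (Fin m) ℝ)
    (t : Fin σ₁) : stackRows X Y (Fin.castAdd σ₃ t) = X t := by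
  funext i
  simp [stackRows, Fin.append_left]

/-- Rows of the second block. [folklore] -/
private theorem stackRows_natAdd (X : Matrix (Fin σ₁) (Fin m) ℝ) (Y : Matrix (Fin σ₃) (Fin m) ℝ)
    (t : Fin σ₃) : stackRows X Y (Fin.natAdd σ₁ t) = Y t := by
  funext i
  simp [stackRows, Fin.append_right]

/-- Entrywise domination is preserved by stacking. [cite: ChiaEtAl2022, §2.2 (oversampling,
entrywise domination convention of the tree's witnesses)] -/
theorem stackRows_sq_le {X Xt : Matrix (Fin σ₁) (Fin m) ℝ} {Y Yt : Matrix (Fin σ₃) (Fin m) ℝ}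
    (hX : ∀ t i, X t i ^ 2 ≤ Xt t i ^ 2) (hY : ∀ t i, Y t i ^ 2 ≤ Yt t i ^ 2) :
    ∀ t i, stackRows X Y t i ^ 2 ≤ stackRows Xt Yt t i ^ 2 := by
  intro t i
  simp only [stackRows]
  induction t using Fin.addCases with
  | left t => simpa only [Fin.append_left] using hX t i
  | right t => simpa only [Fin.append_right] using hY t i

/-- `matVecEst` as a transpose–matrix–vector product of the sketched rows:
`u = (S Rᵀ)ᵀ c` with `c(τ) = (S·colOf b)(τ,0)`. [cite: ChiaEtAl2022, §3.2 (approximate matrix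
product by importance sampling)] -/
theorem matVecEst_eq_transpose_mulVec (R : Matrix (Fin s) (Fin n) ℝ) (b : Fin n → ℝ)
    (p : Fin n → ℝ) (ω' : Fin σ₃ → Fin n) :
    matVecEst R b p ω' = (sketch p ω' * Rᵀ)ᵀ *ᵥ fun τ => (sketch p ω' * colOf b) τ 0 := by
  funext t
  rfl

/-- **`v` is one linear combination of the `σ₁ + σ₃` sampled columns**:
`PMu + q₀·A″b″ = [S₁Aᵀ; S₃Aᵀ]ᵀ (z₁ ⊕ z₃)` with `z₁ = (S₁Rᵀ)(Mu)` and `z₃ = q₀·(S₃·colOf b)(·,0)`.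
[cite: ChiaEtAl2022, §3.3 proof of Theorem 3.4, odd case ("`v` is a linear combination of columns
of `A`; via (lemma:sample-Mv), we can get `SQ_φ(v)`", p. 21 L72)] -/
theorem odd_output_eq_stack (A : Matrix (Fin m) (Fin n) ℝ) (R : Matrix (Fin s) (Fin n) ℝ)
    (M : Matrix (Fin s) (Fin s) ℝ) (q0 : ℝ) (u : Fin s → ℝ) (b : Fin n → ℝ) (p₁ p₃ : Fin n → ℝ)
    (ω₁ : Fin σ₁ → Fin n) (ω₃ : Fin σ₃ → Fin n) :
    ((sketch p₁ ω₁ * Aᵀ)ᵀ * (sketch p₁ ω₁ * Rᵀ)) *ᵥ (M *ᵥ u) + q0 • matVecEst A b p₃ ω₃ =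
      (stackRows (sketch p₁ ω₁ * Aᵀ) (sketch p₃ ω₃ * Aᵀ))ᵀ *ᵥ
        Fin.append ((sketch p₁ ω₁ * Rᵀ) *ᵥ (M *ᵥ u))
          (q0 • fun τ => (sketch p₃ ω₃ * colOf b) τ 0) := by
  rw [stackRows_transpose_mulVec, Matrix.mulVec_smul, ← matVecEst_eq_transpose_mulVec,
    ← Matrix.mulVec_mulVec]

/-- **Oversampling access to a stacked linear combination over dominating data** — the pattern of
`EvenPolySVT.Output.outputWitness` (entrywise-dominating rows, factor = number of terms + 1) for
`v = Xᵀz₁ + Yᵀz₃ ≠ 0` with `X ⊑ X̃`, `Y ⊑ Ỹ` entrywise: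
`ṽ(i)² = (σ₁ + σ₃ + 1)(Σ_t z₁(t)²X̃(t,i)² + Σ_t z₃(t)²Ỹ(t,i)²)`, `φ_v = ‖ṽ‖²/‖v‖²`.
[cite: ChiaEtAl2022, §2.2 (Linear combinations, Lemma "sample-Mv"); TangEwin2019, Prop. 4.3] -/
def oddOutputWitness {X Xt : Matrix (Fin σ₁) (Fin m) ℝ} {Y Yt : Matrix (Fin σ₃) (Fin m) ℝ}
    (hX : ∀ t i, X t i ^ 2 ≤ Xt t i ^ 2) (hY : ∀ t i, Y t i ^ 2 ≤ Yt t i ^ 2) (z₁ : Fin σ₁ → ℝ)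
    (z₃ : Fin σ₃ → ℝ) (hne : Xᵀ *ᵥ z₁ + Yᵀ *ᵥ z₃ ≠ 0) :
    OversamplingWitness
      (normSq (outputTilde (stackRows Xt Yt) 0 (Fin.append z₁ z₃) 0) / normSq (Xᵀ *ᵥ z₁ + Yᵀ *ᵥ z₃))
      (Xᵀ *ᵥ z₁ + Yᵀ *ᵥ z₃) where
  tilde := outputTilde (stackRows Xt Yt) 0 (Fin.append z₁ z₃) 0
  normSq_tilde := by rw [div_mul_cancel₀ _ (normSq_pos hne).ne']
  sq_le i := by
    have h := sq_output_le_outputTilde_sq (stackRows_sq_le hX hY) (b := 0) (bt := 0)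
      (fun _ => le_rfl) (Fin.append z₁ z₃) 0 i
    rwa [stackRows_transpose_mulVec, zero_smul, add_zero] at h

/-- **`SQ_φ(v)` for the odd output**: along ANY sample sequences `ω₁` (distribution `p₁`) and `ω₃`
(distribution `p₃`), the sketched column families `S₁Aᵀ`, `S₃Aᵀ` are dominated entrywise by
`S₁Ãᵀ`, `S₃Ãᵀ` (tree `sketch_sq_le_sketch_tilde_sq`, `Ãᵀ` the witness of `SQ_{φ_c}(Aᵀ)`), so
`oddOutputWitness` gives oversampling access to `v = (S₁Aᵀ)ᵀz₁ + (S₃Aᵀ)ᵀz₃ ≠ 0` — at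
`z₁ = (S₁Rᵀ)(Mu)`, `z₃ = q₀·(S₃·colOf b)(·,0)` this is the print's `SQ_φ(v)` (`odd_output_eq_stack`).
For `p₁ = 𝒟_{Ã-columns}` each dominating row of the first block has `‖(S₁Ãᵀ)_t‖² = φ_c‖A‖_F²/σ₁`
where its weight is positive (tree `normSq_sketch_tilde_row`); the second block is sampled from
`𝒟_{b̃}`, so its row norms are read off the data, as in the print's display.
[cite: ChiaEtAl2022, §3.3 proof of Theorem 3.4, odd case (the `φ·s_φ(v)` display, p. 21 L73–84);
TangEwin2019, Prop. 4.3] -/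
def oddSketchWitness {ϕc : ℝ} {A : Matrix (Fin m) (Fin n) ℝ} (Wc : MatrixOversamplingWitness ϕc Aᵀ)
    (p₁ p₃ : Fin n → ℝ) (ω₁ : Fin σ₁ → Fin n) (ω₃ : Fin σ₃ → Fin n) (z₁ : Fin σ₁ → ℝ)
    (z₃ : Fin σ₃ → ℝ)
    (hne : (sketch p₁ ω₁ * Aᵀ)ᵀ *ᵥ z₁ + (sketch p₃ ω₃ * Aᵀ)ᵀ *ᵥ z₃ ≠ 0) :
    OversamplingWitness
      (normSq (outputTilde (stackRows (sketch p₁ ω₁ * Wc.tilde) (sketch p₃ ω₃ * Wc.tilde)) 0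
          (Fin.append z₁ z₃) 0) /
        normSq ((sketch p₁ ω₁ * Aᵀ)ᵀ *ᵥ z₁ + (sketch p₃ ω₃ * Aᵀ)ᵀ *ᵥ z₃))
      ((sketch p₁ ω₁ * Aᵀ)ᵀ *ᵥ z₁ + (sketch p₃ ω₃ * Aᵀ)ᵀ *ᵥ z₃) :=
  oddOutputWitness (fun t i => sketch_sq_le_sketch_tilde_sq Wc p₁ ω₁ t i)
    (fun t i => sketch_sq_le_sketch_tilde_sq Wc p₃ ω₃ t i) z₁ z₃ hne

/-- **The oversampling factor's numerator**:
`‖ṽ‖² = (σ₁ + σ₃ + 1)·(Σ_t z₁(t)²‖X̃_t‖² + Σ_t z₃(t)²‖Ỹ_t‖²)` — the print's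
`Σ_i ‖A′(·,i)‖²|z₁(i)|² + Σ_j q(0)²‖A″(·,j)‖²|b″(j)|²` over dominating data, with the tree's
`linCombTilde` factor (number of terms `+ 1`, the vacuous extra term being the zero vector).
[cite: ChiaEtAl2022, §3.3 proof of Theorem 3.4, odd case (the `φ·s_φ(v)` display, p. 21 L78);
TangEwin2019, Prop. 4.3] -/
theorem normSq_oddOutputTilde (Xt : Matrix (Fin σ₁) (Fin m) ℝ) (Yt : Matrix (Fin σ₃) (Fin m) ℝ)
    (z₁ : Fin σ₁ → ℝ) (z₃ : Fin σ₃ → ℝ) :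
    normSq (outputTilde (stackRows Xt Yt) 0 (Fin.append z₁ z₃) 0) =
      ((σ₁ + σ₃ : ℕ) + 1) * (∑ t, z₁ t ^ 2 * normSq (Xt t) + ∑ t, z₃ t ^ 2 * normSq (Yt t)) := by
  rw [normSq_outputTilde]
  congr 1
  have h0 : normSq (0 : Fin m → ℝ) = 0 := by simp [normSq]
  rw [h0, mul_zero, add_zero, Fin.sum_univ_add]
  simp only [stackRows_castAdd, stackRows_natAdd, Fin.append_left, Fin.append_right]

end Literature.Computability.QuantumComplexity.SampleQuery.OddPolySVT.Output
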